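import Literature.LinearAlgebra.Matrix.IntegerSymplecticInvolutionConjugacyClasses
import HarnessLib

/-!
# Goresky–Tai 2017, Proposition 50 (second assertion): for even level `N`, every `τ₀`-cocycle of the principal
# congruence subgroup `K⁰_N ⊂ Sp_{2n}(ℤ)` is an `Sp_{2n}(ℤ)`-coboundary

Goresky–Tai, *Real structures on ordinary abelian varieties*, arXiv:1701.07742, Appendix §20.6 p0047–p0048
(verbatim):

> «**Proposition 50.** Let `R` be an integral domain containing `½`. Then `H¹(⟨τ₀⟩, Sp_{2n}(R))` is trivial.
> If `2|N` the mapping `H¹(⟨τ₀⟩, K⁰_N) → H¹(⟨τ₀⟩, Sp_{2n}(ℤ))` is trivial. …»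
> where (§20.4, §20.6) «`K⁰_N = ker(Sp_{2n}(ℤ) → Sp_{2n}(ℤ/Nℤ))`».
> Proof of the second statement: «suppose `N ≥ 2` is even.  Suppose `α ∈ Sp_{2n}(⟨τ₀⟩, K⁰_N)` is a cocycle.
> Then `ατ₀` is an involution which, by Lemma (lem-Z-involutions) [Lemma 45] implies that there exists
> `h ∈ Sp_{2n}(ℤ)` so that `h⁻¹αh̃ = (I B; 0 I)` where `B` is a symmetric matrix of zeroes and ones.  It now
> suffices to show that `B = 0` which follows from the fact that `α ≡ I mod 2` and that `h⁻¹h̃ ≡ I mod 2`, for if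
> `h = (a b; c d)` then `h⁻¹h̃ = I + 2(bᵗc bᵗa; cᵗd bᵗc)`.»

and §20.1 p0046: «For `g ∈ Sp(2n, R)` let `g̃ = τ₀gτ₀⁻¹`. … a 1-cocycle … `f(τ₀) = g` where `gg̃ = I`. … two
cocycles `f_g, f_{g′}` are cohomologous if there exists `h ∈ Γ` such that `g′ = h⁻¹gh̃` or equivalently, such that
`g′ = h̃gh⁻¹`.»  (So the class of `α` is trivial in `H¹(⟨τ₀⟩, Sp_{2n}(ℤ))` iff `α = h⁻¹h̃` for some `h ∈ Sp_{2n}(ℤ)`,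
equivalently `α = h̃h⁻¹`.)

## What is formalized (Mathlib conventions: `J = Matrix.J m ℤ = (0 −1; 1 0)`, `Sp = Matrix.symplecticGroup m ℤ`,
## `τ₀ = (−1 0; 0 1)`, `h̃ = τ₀hτ₀`, `u(B) = (1 B; 0 −1)`, `n(T) = (1 T; 0 1)`; `K⁰_N`-membership as `α ∈ Sp ∧ α ≡ 1 (mod N)`)

* §1 «`α ≡ I mod 2`» and «`h⁻¹h̃ ≡ I mod 2`»: `map_tau0_eq_one` (`τ₀ ≡ 1 (mod 2)`), `map_eq_one_of_map_eq_one_of_two_dvd`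
  (`α ≡ 1 (mod N)`, `2 ∣ N` ⟹ `α ≡ 1 (mod 2)`), ★ `map_inv_mul_twist_eq_one` / `two_dvd_inv_mul_twist_sub_one`
  (for EVERY integer matrix `h` with `hh′ = 1`: `h′h̃ ≡ 1 (mod 2)` — the reduction modulo `2` of the displayed
  identity `h⁻¹h̃ = I + 2(…)`), `J_mul_tau0_mul_J` (`Jτ₀J = τ₀`), `neg_one_eq_coboundary` (the central sign:
  `−1 = J⁻¹J̃`, a coboundary).
* §2 «It now suffices to show that `B = 0`»: ★ `map_eq_zero_of_conj_eq_upperInvolution` — if `g′(ατ₀)g = u(B)` with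
  `g′g = 1` and `α ≡ 1 (mod 2)`, then `B ≡ 0 (mod 2)`; `exists_eq_two_smul_of_map_eq_zero` (`B = 2C`, `C` symmetric);
  `upperInvolution_two_smul_eq_conj` (`u(2C) = n(−C)·(−τ₀)·n(C)`: an even `B` is conjugated away).
* §3 ★★★ `exists_eq_inv_mul_twist_of_cocycle` — **Proposition 50, second assertion**: if `2 ∣ N`, `α ∈ Sp_{2n}(ℤ)`,
  `α ≡ 1 (mod N)` and `αα̃ = 1`, then `α = h′h̃` for some `h ∈ Sp_{2n}(ℤ)`, `hh′ = 1` («`g′ = h⁻¹gh̃`» with `g = 1`: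
  the class of `α` in `H¹(⟨τ₀⟩, Sp_{2n}(ℤ))` is trivial); ★ `exists_eq_twist_mul_inv_of_cocycle` (the «equivalent»
  form `α = k̃k′`, `kk′ = 1`).

Remark on the print.  In these conventions `h⁻¹(ατ₀)h = u(B)` gives `h⁻¹αh̃ = u(B)τ₀ = −(1 −B; 0 1)`, not
«`(I B; 0 I)`»: the central sign is absorbed by the coboundary `−1 = J⁻¹J̃` (`neg_one_eq_coboundary`), which is how
§3 concludes.  `K⁰_N` is written with bare matrices (`α ∈ Sp`, `α.map (ℤ → ℤ/N) = 1`) exactly as printed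
(«`ker(Sp_{2n}(ℤ) → Sp_{2n}(ℤ/Nℤ))`»); the tree's `siegelPrincipalGamma` (Siegel modular forms) is the same group
as a subgroup of `Γ_g` and is not imported here.  THEOREMS ONLY; no definition, instance, notation or named fact.

## References

* [GoreskyTai2017RealStructuresOrdinary] M. Goresky, Y.-S. Tai, *Real structures on ordinary abelian varieties*,
  arXiv:1701.07742 (2017), Appendix §20.1, §20.4 (`K⁰_N`), §19.2 Lemma 45, §20.6 Proposition 50 (second assertion)
  and its proof.
-/

noncomputable section

open Matrix

namespace Literature.LinearAlgebra.Matrix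

namespace IntegerSymplecticInvolution

variable {m : Type*} [Fintype m] [DecidableEq m]

/-! ## §1 Reductions modulo `2`: `τ₀ ≡ 1`, `α ≡ 1`, `h⁻¹h̃ ≡ 1`; the sign `−1` is a coboundary -/

/-- If `g ∈ Sp` and `gg′ = 1` then `g′ ∈ Sp` (`g′ = −Jᵗg J`). [folklore] -/
private theorem inv_mem_symplecticGroup {g g' : Matrix (m ⊕ m) (m ⊕ m) ℤ}
    (hg : g ∈ Matrix.symplecticGroup m ℤ) (h : g * g' = 1) : g' ∈ Matrix.symplecticGroup m ℤ := by
  have e : g' = -(Matrix.J m ℤ * gᵀ * Matrix.J m ℤ) := by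
    calc g' = -(Matrix.J m ℤ * gᵀ * Matrix.J m ℤ * g) * g' := by
          rw [SymplecticGroup.inv_left_mul_aux hg, Matrix.one_mul]
      _ = -(Matrix.J m ℤ * gᵀ * Matrix.J m ℤ) * (g * g') := by simp only [Matrix.neg_mul, Matrix.mul_assoc]
      _ = -(Matrix.J m ℤ * gᵀ * Matrix.J m ℤ) := by rw [h, Matrix.mul_one]
  rw [e]
  exact SymplecticGroup.neg_mem (Submonoid.mul_mem _ (Submonoid.mul_mem _ (SymplecticGroup.J_mem m ℤ)
    (SymplecticGroup.transpose_mem hg)) (SymplecticGroup.J_mem m ℤ))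

omit [Fintype m] in
/-- **`τ₀ ≡ I (mod 2)`** (`−1 ≡ 1`). [cite: GoreskyTai2017RealStructuresOrdinary, App. §20.6 Proposition 50 (proof:
«`h⁻¹h̃ ≡ I mod 2`»)] -/
theorem map_tau0_eq_one :
    (fromBlocks (-1 : Matrix m m ℤ) 0 0 (1 : Matrix m m ℤ)).map (Int.castRingHom (ZMod 2)) = 1 := by
  rw [fromBlocks_map, ← fromBlocks_one]
  have h1 : (1 : Matrix m m ℤ).map (Int.castRingHom (ZMod 2)) = 1 := Matrix.map_one _ (map_zero _) (map_one _)
  have h0 : (0 : Matrix m m ℤ).map (Int.castRingHom (ZMod 2)) = 0 := Matrix.map_zero _ (map_zero _)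
  have hn : (-1 : Matrix m m ℤ).map (Int.castRingHom (ZMod 2)) = 1 := by
    rw [Matrix.map_neg (⇑(Int.castRingHom (ZMod 2))) (map_neg (Int.castRingHom (ZMod 2))), h1]
    ext i j
    by_cases h : i = j
    · subst h
      simp only [Matrix.neg_apply, Matrix.one_apply_eq]
      decide
    · simp [h]
  rw [h1, h0, hn]

/-- **«`α ≡ I mod 2`»**: a matrix congruent to `1` modulo an even `N` is congruent to `1` modulo `2`.
[cite: GoreskyTai2017RealStructuresOrdinary, App. §20.6 Proposition 50 (proof)] -/
theorem map_eq_one_of_map_eq_one_of_two_dvd {ι : Type*} [DecidableEq ι] {N : ℕ} (hN : 2 ∣ N) {α : Matrix ι ι ℤ}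
    (hα : α.map (Int.castRingHom (ZMod N)) = 1) : α.map (Int.castRingHom (ZMod 2)) = 1 := by
  have e : (⇑(Int.castRingHom (ZMod 2)) : ℤ → ZMod 2) = ⇑(ZMod.castHom hN (ZMod 2)) ∘ ⇑(Int.castRingHom (ZMod N)) := by
    rw [← RingHom.coe_comp, RingHom.ext_int ((ZMod.castHom hN (ZMod 2)).comp (Int.castRingHom (ZMod N)))
      (Int.castRingHom (ZMod 2))]
  rw [e, ← Matrix.map_map, hα, Matrix.map_one _ (map_zero _) (map_one _)]

/-- ★ **«`h⁻¹h̃ ≡ I mod 2`»** — for every integer matrix `h` with inverse `h′` (`hh′ = 1`), `h′·(τ₀hτ₀) ≡ 1 (mod 2)`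
(because `τ₀ ≡ 1`): the reduction modulo `2` of the displayed identity «`h⁻¹h̃ = I + 2(bᵗc bᵗa; cᵗd bᵗc)`».
[cite: GoreskyTai2017RealStructuresOrdinary, App. §20.6 Proposition 50 (proof)] -/
theorem map_inv_mul_twist_eq_one {h h' : Matrix (m ⊕ m) (m ⊕ m) ℤ} (hhh' : h * h' = 1) :
    (h' * (fromBlocks (-1 : Matrix m m ℤ) 0 0 (1 : Matrix m m ℤ) * h * fromBlocks (-1 : Matrix m m ℤ) 0 0 (1 : Matrix m m ℤ))).map
      (Int.castRingHom (ZMod 2)) = 1 := by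
  have hh'h : h' * h = 1 := mul_eq_one_comm.1 hhh'
  rw [Matrix.map_mul, Matrix.map_mul, Matrix.map_mul, map_tau0_eq_one, Matrix.mul_one, Matrix.one_mul,
    ← Matrix.map_mul, hh'h, Matrix.map_one _ (map_zero _) (map_one _)]

/-- The same, entrywise over `ℤ`: every entry of `h′h̃ − 1` is even. [cite: GoreskyTai2017RealStructuresOrdinary,
App. §20.6 Proposition 50 (proof: «`h⁻¹h̃ = I + 2(…)`»)] -/
theorem two_dvd_inv_mul_twist_sub_one {h h' : Matrix (m ⊕ m) (m ⊕ m) ℤ} (hhh' : h * h' = 1) (i j : m ⊕ m) :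
    (2 : ℤ) ∣ (h' * (fromBlocks (-1 : Matrix m m ℤ) 0 0 (1 : Matrix m m ℤ) * h * fromBlocks (-1 : Matrix m m ℤ) 0 0 (1 : Matrix m m ℤ)) - 1) i j := by
  have e0 : (h' * (fromBlocks (-1 : Matrix m m ℤ) 0 0 (1 : Matrix m m ℤ) * h * fromBlocks (-1 : Matrix m m ℤ) 0 0 (1 : Matrix m m ℤ)) - 1).map
      (Int.castRingHom (ZMod 2)) = 0 := by
    rw [Matrix.map_sub _ (map_sub (Int.castRingHom (ZMod 2))), map_inv_mul_twist_eq_one hhh',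
      Matrix.map_one _ (map_zero _) (map_one _), sub_self]
  have e := congr_fun (congr_fun e0 i) j
  rw [Matrix.map_apply, eq_intCast, Matrix.zero_apply, ZMod.intCast_zmod_eq_zero_iff_dvd, Nat.cast_ofNat] at e
  exact e

/-- `Jτ₀J = τ₀`. [cite: GoreskyTai2017RealStructuresOrdinary, App. §19.1 (the standard involution `τ₀`)] -/
theorem J_mul_tau0_mul_J :
    Matrix.J m ℤ * fromBlocks (-1 : Matrix m m ℤ) 0 0 (1 : Matrix m m ℤ) * Matrix.J m ℤ =
      fromBlocks (-1 : Matrix m m ℤ) 0 0 (1 : Matrix m m ℤ) := by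
  rw [Matrix.J, fromBlocks_multiply, fromBlocks_multiply]
  simp

/-- **The central sign is a coboundary: `−1 = J⁻¹J̃ = (−J)·(τ₀Jτ₀)`** (with `J·(−J) = 1`, `J ∈ Sp_{2n}(ℤ)`).
[cite: GoreskyTai2017RealStructuresOrdinary, App. §20.1 (coboundaries `h⁻¹h̃`) and §20.6 Proposition 50 (proof)] -/
theorem neg_one_eq_coboundary :
    (-1 : Matrix (m ⊕ m) (m ⊕ m) ℤ) =
      -Matrix.J m ℤ * (fromBlocks (-1 : Matrix m m ℤ) 0 0 (1 : Matrix m m ℤ) * Matrix.J m ℤ *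
        fromBlocks (-1 : Matrix m m ℤ) 0 0 (1 : Matrix m m ℤ)) := by
  rw [tau0_mul_J_mul_tau0, Matrix.mul_neg, Matrix.neg_mul, neg_neg, Matrix.J_squared]

/-! ## §2 «It now suffices to show that `B = 0`»: an even `B` is conjugated away -/

/-- ★ **`B ≡ 0 (mod 2)`**: if `g′(ατ₀)g = u(B)` with `g′g = 1` and `α ≡ 1 (mod 2)`, then `B̄ = 0` («which follows from
the fact that `α ≡ I mod 2` and that `h⁻¹h̃ ≡ I mod 2`»: `u(B) ≡ g′τ₀g ≡ g′g = 1`).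
[cite: GoreskyTai2017RealStructuresOrdinary, App. §20.6 Proposition 50 (proof)] -/
theorem map_eq_zero_of_conj_eq_upperInvolution {α g g' : Matrix (m ⊕ m) (m ⊕ m) ℤ} {B : Matrix m m ℤ}
    (hα : α.map (Int.castRingHom (ZMod 2)) = 1) (hg'g : g' * g = 1)
    (hconj : g' * (α * fromBlocks (-1 : Matrix m m ℤ) 0 0 (1 : Matrix m m ℤ)) * g = fromBlocks (1 : Matrix m m ℤ) B 0 (-1 : Matrix m m ℤ)) :
    B.map (Int.castRingHom (ZMod 2)) = 0 := by
  have e := congrArg (fun X : Matrix (m ⊕ m) (m ⊕ m) ℤ => (X.map (Int.castRingHom (ZMod 2))).toBlocks₁₂) hconj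
  rw [Matrix.map_mul, Matrix.map_mul, Matrix.map_mul, hα, map_tau0_eq_one, Matrix.mul_one, Matrix.mul_one,
    ← Matrix.map_mul, hg'g, Matrix.map_one _ (map_zero _) (map_one _), ← fromBlocks_one, fromBlocks_map,
    toBlocks_fromBlocks₁₂, toBlocks_fromBlocks₁₂] at e
  exact e.symm

omit [Fintype m] [DecidableEq m] in
/-- An even symmetric integer matrix is `2C` with `C` symmetric. [folklore] -/
private theorem exists_eq_two_smul_of_map_eq_zero {B : Matrix m m ℤ} (hB : Bᵀ = B)
    (h0 : B.map (Int.castRingHom (ZMod 2)) = 0) : ∃ C : Matrix m m ℤ, Cᵀ = C ∧ B = (2 : ℕ) • C := by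
  have hdvd : ∀ i j, (2 : ℤ) ∣ B i j := fun i j => by
    have e := congr_fun (congr_fun h0 i) j
    rw [Matrix.map_apply, eq_intCast, Matrix.zero_apply, ZMod.intCast_zmod_eq_zero_iff_dvd, Nat.cast_ofNat] at e
    exact e
  refine ⟨Matrix.of fun i j => B i j / 2, ?_, ?_⟩
  · ext i j
    have hij : B j i = B i j := by rw [← transpose_apply B i j, hB]
    rw [transpose_apply, of_apply, of_apply, hij]
  · ext i j
    rw [Matrix.smul_apply, of_apply, nsmul_eq_mul, Nat.cast_ofNat]
    exact (Int.mul_ediv_cancel' (hdvd i j)).symm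

/-- `n(T)n(−T) = 1`. [folklore] -/
private theorem unipotent_mul_unipotent_neg' (T : Matrix m m ℤ) :
    fromBlocks (1 : Matrix m m ℤ) T 0 (1 : Matrix m m ℤ) * fromBlocks (1 : Matrix m m ℤ) (-T) 0 (1 : Matrix m m ℤ) = 1 := by
  rw [fromBlocks_multiply, ← fromBlocks_one]
  simp

/-- **An even `B` is conjugated away**: `u(2C) = n(−C)·u(0)·n(C)` and `u(0) = (1 0; 0 −1) = −τ₀`, so
`u(2C) = −(n(−C)·τ₀·n(C))` with `n(−C) ∈ Sp_{2n}(ℤ)` for `C` symmetric («Conjugating `τ` by any element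
`(I T; 0 I) ∈ Sp_{2n}(ℤ)` … `B` can be modified by the addition of an even number»).
[cite: GoreskyTai2017RealStructuresOrdinary, App. §19.2 proof of Lemma 45 and §20.6 Proposition 50 (proof: «`B = 0`»)] -/
theorem upperInvolution_two_smul_eq_conj (C : Matrix m m ℤ) :
    fromBlocks (1 : Matrix m m ℤ) ((2 : ℕ) • C) 0 (-1 : Matrix m m ℤ) =
      -(fromBlocks (1 : Matrix m m ℤ) (-C) 0 (1 : Matrix m m ℤ) * fromBlocks (-1 : Matrix m m ℤ) 0 0 (1 : Matrix m m ℤ) *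
        fromBlocks (1 : Matrix m m ℤ) C 0 (1 : Matrix m m ℤ)) := by
  have h0 : fromBlocks (1 : Matrix m m ℤ) (0 : Matrix m m ℤ) 0 (-1 : Matrix m m ℤ) = -fromBlocks (-1 : Matrix m m ℤ) 0 0 (1 : Matrix m m ℤ) := by
    rw [fromBlocks_neg, neg_neg, neg_zero]
  have h1 := unipotent_conj_upperInvolution (0 : Matrix m m ℤ) (-C)
  rw [neg_neg, zero_sub, smul_neg, neg_neg, h0, Matrix.mul_neg, Matrix.neg_mul] at h1
  exact h1.symm

/-! ## §3 Proposition 50, second assertion -/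

/-- ★★★ **Goresky–Tai 2017, Proposition 50, second assertion: «If `2|N` the mapping `H¹(⟨τ₀⟩, K⁰_N) →
H¹(⟨τ₀⟩, Sp_{2n}(ℤ))` is trivial.»**  For `2 ∣ N` and `α ∈ K⁰_N = ker(Sp_{2n}(ℤ) → Sp_{2n}(ℤ/Nℤ))` (i.e.
`α ∈ Sp_{2n}(ℤ)`, `α ≡ 1 (mod N)`) with `αα̃ = 1` (`α̃ = τ₀ατ₀`), there is `h ∈ Sp_{2n}(ℤ)` with inverse `h′` such
that `α = h′h̃` («`g′ = h⁻¹gh̃`» with `g = 1`: `α` is cohomologous to the trivial cocycle in `Sp_{2n}(ℤ)`).  Proof as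
printed: `ατ₀` is an involution of multiplier `−1`, conjugate by Lemma 45 to `u(B)`; `B ≡ 0 (mod 2)` by §1–§2, so
`u(B) = u(2C)` is conjugate to `u(0) = −τ₀`; the sign is the coboundary `J⁻¹J̃`.
[cite: GoreskyTai2017RealStructuresOrdinary, App. §20.6 Proposition 50 (second assertion) and proof; §19.2 Lemma 45] -/
theorem exists_eq_inv_mul_twist_of_cocycle {N : ℕ} (hN : 2 ∣ N) {α : Matrix (m ⊕ m) (m ⊕ m) ℤ}
    (hαSp : α ∈ Matrix.symplecticGroup m ℤ) (hαN : α.map (Int.castRingHom (ZMod N)) = 1)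
    (hcoc : α * (fromBlocks (-1 : Matrix m m ℤ) 0 0 (1 : Matrix m m ℤ) * α * fromBlocks (-1 : Matrix m m ℤ) 0 0 (1 : Matrix m m ℤ)) = 1) :
    ∃ h h' : Matrix (m ⊕ m) (m ⊕ m) ℤ, h ∈ Matrix.symplecticGroup m ℤ ∧ h * h' = 1 ∧
      α = h' * (fromBlocks (-1 : Matrix m m ℤ) 0 0 (1 : Matrix m m ℤ) * h * fromBlocks (-1 : Matrix m m ℤ) 0 0 (1 : Matrix m m ℤ)) := by
  -- `τ = ατ₀` is an involution of multiplier `−1`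
  set τ : Matrix (m ⊕ m) (m ⊕ m) ℤ := α * fromBlocks (-1 : Matrix m m ℤ) 0 0 (1 : Matrix m m ℤ) with hτdef
  have hττ : τ * τ = 1 := (mul_tau0_mul_self_eq_one_iff α).2 hcoc
  have hJτ : τᵀ * Matrix.J m ℤ * τ = -Matrix.J m ℤ := (mul_tau0_multiplier_iff α).2 hαSp
  -- Lemma 45: `g′τg = u(B)`
  obtain ⟨g, g', B, hg, hg', hg'g, hB, hconj⟩ := exists_symplectic_conj_eq_upperInvolution τ hττ hJτ
  have hgg' : g * g' = 1 := mul_eq_one_comm.1 hg'g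
  -- `B ≡ 0 (mod 2)`, `B = 2C`
  have hα2 : α.map (Int.castRingHom (ZMod 2)) = 1 := map_eq_one_of_map_eq_one_of_two_dvd hN hαN
  obtain ⟨C, hC, rfl⟩ := exists_eq_two_smul_of_map_eq_zero hB (map_eq_zero_of_conj_eq_upperInvolution hα2 hg'g hconj)
  -- `τ = g u(2C) g′ = −(k τ₀ k′)` with `k = g n(−C)`, `k′ = n(C) g′`
  have hτ : τ = g * fromBlocks (1 : Matrix m m ℤ) ((2 : ℕ) • C) 0 (-1 : Matrix m m ℤ) * g' := by
    rw [← hconj]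
    calc τ = (g * g') * τ * (g * g') := by rw [hgg', Matrix.one_mul, Matrix.mul_one]
      _ = g * (g' * τ * g) * g' := by simp only [Matrix.mul_assoc]
  set k : Matrix (m ⊕ m) (m ⊕ m) ℤ := g * fromBlocks (1 : Matrix m m ℤ) (-C) 0 (1 : Matrix m m ℤ) with hkdef
  set k' : Matrix (m ⊕ m) (m ⊕ m) ℤ := fromBlocks (1 : Matrix m m ℤ) C 0 (1 : Matrix m m ℤ) * g' with hk'def
  have hk : k ∈ Matrix.symplecticGroup m ℤ := by
    refine Submonoid.mul_mem _ hg ((unipotent_mem_symplecticGroup_iff (-C)).2 ?_)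
    rw [transpose_neg, hC]
  have hkk' : k * k' = 1 := by
    have hnn : fromBlocks (1 : Matrix m m ℤ) (-C) 0 (1 : Matrix m m ℤ) * fromBlocks (1 : Matrix m m ℤ) C 0 (1 : Matrix m m ℤ) = 1 := by
      simpa only [neg_neg] using unipotent_mul_unipotent_neg' (-C)
    calc k * k' = g * (fromBlocks (1 : Matrix m m ℤ) (-C) 0 (1 : Matrix m m ℤ) * fromBlocks (1 : Matrix m m ℤ) C 0 (1 : Matrix m m ℤ)) * g' := by
          simp only [hkdef, hk'def, Matrix.mul_assoc]
      _ = 1 := by rw [hnn, Matrix.mul_one, hgg']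
  have hτk : τ = -(k * fromBlocks (-1 : Matrix m m ℤ) 0 0 (1 : Matrix m m ℤ) * k') := by
    rw [hτ, upperInvolution_two_smul_eq_conj, Matrix.mul_neg, Matrix.neg_mul]
    simp only [hkdef, hk'def, Matrix.mul_assoc]
  -- `α = −k τ₀ k′ τ₀`
  have hαk : α = -(k * fromBlocks (-1 : Matrix m m ℤ) 0 0 (1 : Matrix m m ℤ) * k' * fromBlocks (-1 : Matrix m m ℤ) 0 0 (1 : Matrix m m ℤ)) := by
    calc α = τ * fromBlocks (-1 : Matrix m m ℤ) 0 0 (1 : Matrix m m ℤ) := by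
          rw [hτdef, Matrix.mul_assoc, tau0_mul_tau0, Matrix.mul_one]
      _ = _ := by rw [hτk, Matrix.neg_mul]
  -- the coboundary: `h = (−J) k′`, `h′ = k J`
  have hk' : k' ∈ Matrix.symplecticGroup m ℤ := inv_mem_symplecticGroup hk hkk'
  have hk'k : k' * k = 1 := mul_eq_one_comm.1 hkk'
  refine ⟨-Matrix.J m ℤ * k', k * Matrix.J m ℤ,
    Submonoid.mul_mem _ (SymplecticGroup.neg_mem (SymplecticGroup.J_mem m ℤ)) hk', ?_, ?_⟩
  · calc -Matrix.J m ℤ * k' * (k * Matrix.J m ℤ) = -(Matrix.J m ℤ * (k' * k) * Matrix.J m ℤ) := by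
          simp only [Matrix.neg_mul, Matrix.mul_assoc]
      _ = 1 := by rw [hk'k, Matrix.mul_one, Matrix.J_squared, neg_neg]
  · rw [hαk]
    calc -(k * fromBlocks (-1 : Matrix m m ℤ) 0 0 (1 : Matrix m m ℤ) * k' * fromBlocks (-1 : Matrix m m ℤ) 0 0 (1 : Matrix m m ℤ))
        = -(k * (Matrix.J m ℤ * fromBlocks (-1 : Matrix m m ℤ) 0 0 (1 : Matrix m m ℤ) * Matrix.J m ℤ) * k' *
            fromBlocks (-1 : Matrix m m ℤ) 0 0 (1 : Matrix m m ℤ)) := by rw [J_mul_tau0_mul_J]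
      _ = k * Matrix.J m ℤ * (fromBlocks (-1 : Matrix m m ℤ) 0 0 (1 : Matrix m m ℤ) * (-Matrix.J m ℤ * k') *
            fromBlocks (-1 : Matrix m m ℤ) 0 0 (1 : Matrix m m ℤ)) := by
          simp only [Matrix.neg_mul, Matrix.mul_neg, Matrix.mul_assoc]

/-- ★ **The «equivalent» form `α = k̃k′`** («`g′ = h̃gh⁻¹`» with `g = 1`): under the same hypotheses
`α = (τ₀kτ₀)·k′` for some `k ∈ Sp_{2n}(ℤ)`, `kk′ = 1` (take `k = τ₀h′τ₀`).
[cite: GoreskyTai2017RealStructuresOrdinary, App. §20.1 («or equivalently, such that `g′ = h̃gh⁻¹`») and §20.6 Proposition 50] -/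
theorem exists_eq_twist_mul_inv_of_cocycle {N : ℕ} (hN : 2 ∣ N) {α : Matrix (m ⊕ m) (m ⊕ m) ℤ}
    (hαSp : α ∈ Matrix.symplecticGroup m ℤ) (hαN : α.map (Int.castRingHom (ZMod N)) = 1)
    (hcoc : α * (fromBlocks (-1 : Matrix m m ℤ) 0 0 (1 : Matrix m m ℤ) * α * fromBlocks (-1 : Matrix m m ℤ) 0 0 (1 : Matrix m m ℤ)) = 1) :
    ∃ k k' : Matrix (m ⊕ m) (m ⊕ m) ℤ, k ∈ Matrix.symplecticGroup m ℤ ∧ k * k' = 1 ∧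
      α = fromBlocks (-1 : Matrix m m ℤ) 0 0 (1 : Matrix m m ℤ) * k * fromBlocks (-1 : Matrix m m ℤ) 0 0 (1 : Matrix m m ℤ) * k' := by
  obtain ⟨h, h', hh, hhh', hα⟩ := exists_eq_inv_mul_twist_of_cocycle hN hαSp hαN hcoc
  have hh' : h' ∈ Matrix.symplecticGroup m ℤ := inv_mem_symplecticGroup hh hhh'
  have hh'h : h' * h = 1 := mul_eq_one_comm.1 hhh'
  refine ⟨fromBlocks (-1 : Matrix m m ℤ) 0 0 (1 : Matrix m m ℤ) * h' * fromBlocks (-1 : Matrix m m ℤ) 0 0 (1 : Matrix m m ℤ),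
    fromBlocks (-1 : Matrix m m ℤ) 0 0 (1 : Matrix m m ℤ) * h * fromBlocks (-1 : Matrix m m ℤ) 0 0 (1 : Matrix m m ℤ),
    tau0_conj_mem_symplecticGroup hh', ?_, ?_⟩
  · calc fromBlocks (-1 : Matrix m m ℤ) 0 0 (1 : Matrix m m ℤ) * h' * fromBlocks (-1 : Matrix m m ℤ) 0 0 (1 : Matrix m m ℤ) *
          (fromBlocks (-1 : Matrix m m ℤ) 0 0 (1 : Matrix m m ℤ) * h * fromBlocks (-1 : Matrix m m ℤ) 0 0 (1 : Matrix m m ℤ))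
          = fromBlocks (-1 : Matrix m m ℤ) 0 0 (1 : Matrix m m ℤ) * (h' *
              (fromBlocks (-1 : Matrix m m ℤ) 0 0 (1 : Matrix m m ℤ) * (fromBlocks (-1 : Matrix m m ℤ) 0 0 (1 : Matrix m m ℤ) * (h *
                fromBlocks (-1 : Matrix m m ℤ) 0 0 (1 : Matrix m m ℤ))))) := by simp only [Matrix.mul_assoc]
      _ = 1 := by
          rw [← Matrix.mul_assoc (fromBlocks (-1 : Matrix m m ℤ) 0 0 (1 : Matrix m m ℤ))
              (fromBlocks (-1 : Matrix m m ℤ) 0 0 (1 : Matrix m m ℤ)), tau0_mul_tau0, Matrix.one_mul,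
            ← Matrix.mul_assoc h', hh'h, Matrix.one_mul, tau0_mul_tau0]
  · rw [hα]
    simp only [Matrix.mul_assoc]
    rw [← Matrix.mul_assoc (fromBlocks (-1 : Matrix m m ℤ) 0 0 (1 : Matrix m m ℤ))
        (fromBlocks (-1 : Matrix m m ℤ) 0 0 (1 : Matrix m m ℤ)), tau0_mul_tau0, Matrix.one_mul,
      ← Matrix.mul_assoc (fromBlocks (-1 : Matrix m m ℤ) 0 0 (1 : Matrix m m ℤ))
        (fromBlocks (-1 : Matrix m m ℤ) 0 0 (1 : Matrix m m ℤ)), tau0_mul_tau0, Matrix.one_mul]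

end IntegerSymplecticInvolution

end Literature.LinearAlgebra.Matrix
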